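import Mathlib
import Summits.ValiantsHypothesis.ValiantsHypothesis.Theses.NewtonUnitEquations
import Literature.Computability.AlgebraicComplexity.NewtonPolygonTauTransfer

/-!
# `TwoProducts` (stmt-ValiantsHypothesis-5906) — negative side: without internal cancellation only
# first-order points are exposed (obstruction F8 of `Cruxes/TwoProducts/Disproof.lean`)

Standing disprover (cdisprove, cycle 1).  The instance `g ≡ const` of the crux is KPTT's §5.2 open problem
`Newt(f₁⋯f_m + 1)`.  This file certifies that its whole difficulty is INTERNAL cancellation inside the product:

* `extremePoint_sdiff_zero_of_sum` — if `S = A_0 + ⋯ + A_{m-1}` (finite sets, each `∋ 0`) then every extreme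
  point of `conv(S ∖ {0})` is an extreme point of `conv S` or an element of some `A_j` (strict exposure via
  geometric Hahn–Banach in any locally convex Hausdorff space; a sum `a + b` of two nonzero points of `S` would give
  `l p = l a + l b ≤ 2·l p` and `l p ≤ 0`-type contradictions);
* `ncard_extremePoints_sdiff_zero_le` — hence `#vert conv(S∖0) ≤ #vert conv S + Σ_j (#A_j − 1)`;
* `newtonVertexCount_sub_const_le_of_support_eq_sum` — for `t`-sparse bivariate `f_j` with constant terms and
  `supp ∏f_j = Σ_j supp f_j` (no internal cancellation): `vert(∏f_j − const) ≤ vert(∏f_j) + Σ_j(|supp f_j| − 1)`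
  (`≤ mt + m(t−1)` by Ostrowski), i.e. digit-product / carry-free radix / Sierpinski-frame constructions can never
  manufacture vertices at `g ≡ 1`.
Uses the tree's `KPTT.convexHull_subset_insert_halfSpace` / `KPTT.mem_extremePoints_convexHull_of_linear`. [folklore]
-/

set_option linter.dupNamespace false

open scoped BigOperators Pointwise

namespace Summit.ValiantsHypothesis.ValiantsHypothesis.Theorems.TwoProducts.Negative

open Literature.Computability.AlgebraicComplexity

noncomputable section

variable {E : Type*} [AddCommGroup E] [Module ℝ E]

/-- An extreme point of the convex hull of `T` is not in the convex hull of the other points. [folklore] -/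
theorem not_mem_convexHull_diff_of_mem_extremePoints {T : Set E} {p : E}
    (hp : p ∈ (convexHull ℝ T).extremePoints ℝ) : p ∉ convexHull ℝ (T \ {p}) := by
  have hconv := ((convex_convexHull ℝ T).mem_extremePoints_iff_convex_sdiff.1 hp).2
  have hsub : convexHull ℝ (T \ {p}) ⊆ convexHull ℝ T \ {p} :=
    convexHull_min (fun x hx => ⟨subset_convexHull ℝ T hx.1, hx.2⟩) hconv
  exact fun h => (hsub h).2 rfl

variable [TopologicalSpace E] [IsTopologicalAddGroup E] [ContinuousSMul ℝ E] [LocallyConvexSpace ℝ E]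
  [T2Space E]

/-- In a locally convex Hausdorff space, an extreme point of the convex hull of a FINITE set is strictly
exposed against the other points of the set by a continuous linear functional. [folklore] -/
theorem exists_strict_exposing_of_finite {T : Set E} (hT : T.Finite) {p : E}
    (hp : p ∈ (convexHull ℝ T).extremePoints ℝ) :
    ∃ l : E →ₗ[ℝ] ℝ, ∀ x ∈ T, x ≠ p → l x < l p := by
  have hnot : p ∉ convexHull ℝ (T \ {p}) := not_mem_convexHull_diff_of_mem_extremePoints hp
  obtain ⟨f, u, hfu, hgt⟩ := geometric_hahn_banach_point_closed (convex_convexHull ℝ (T \ {p}))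
    ((hT.subset Set.sdiff_subset).isClosed_convexHull ℝ) hnot
  refine ⟨-(f : E →ₗ[ℝ] ℝ), fun x hx hxp => ?_⟩
  have hx' : u < f x := hgt x (subset_convexHull ℝ _ ⟨hx, hxp⟩)
  simp only [LinearMap.neg_apply, ContinuousLinearMap.coe_coe, neg_lt_neg_iff]
  exact hfu.trans hx'

omit [Module ℝ E] [TopologicalSpace E] [IsTopologicalAddGroup E] [ContinuousSMul ℝ E] [LocallyConvexSpace ℝ E]
  [T2Space E] in
/-- A Minkowski sum of finitely many finite sets is finite. [folklore] -/
theorem finite_fintype_sum {m : ℕ} (A : Fin m → Finset E) : (∑ j, (A j : Set E)).Finite := by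
  classical
  refine (Set.finite_range (fun g : (∀ j, A j) => ∑ j, ((g j : A j) : E))).subset ?_
  intro x hx
  obtain ⟨g, hg, rfl⟩ := (Set.mem_fintype_sum _ _).1 hx
  exact ⟨fun j => ⟨g j, hg j⟩, rfl⟩

/-- **No internal cancellation ⇒ exposed vertices are first order (obstruction F8).**  Let
`S = A_0 + ⋯ + A_{m-1}` be a Minkowski sum of finite sets each containing `0`.  Every extreme point of
`conv(S ∖ {0})` is either an extreme point of `conv S` or an element of some `A_j` ("first order").
Hence deleting the origin from a cancellation-free product support exposes at most `Σ_j (#A_j - 1)` new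
vertices.  (Proof: `p = Σ a_j`; if two summands are nonzero then `p = a + b` with `a, b ∈ S ∖ 0`; a strict
exposing functional `l` of `p` in `conv(S ∖ 0)` has `l a, l b ≤ l p = l a + l b`, forcing `l p > 0 = l 0`, so `l`
exposes `p` in `conv S` too.) [folklore] -/
theorem extremePoint_sdiff_zero_of_sum {m : ℕ} (A : Fin m → Finset E) (h0 : ∀ j, (0 : E) ∈ A j) {p : E}
    (hp : p ∈ (convexHull ℝ ((∑ j, (A j : Set E)) \ {0})).extremePoints ℝ) :
    p ∈ (convexHull ℝ (∑ j, (A j : Set E))).extremePoints ℝ ∨ ∃ j, p ∈ A j := by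
  classical
  set S : Set E := ∑ j, (A j : Set E) with hS
  have hSfin : S.Finite := finite_fintype_sum A
  have hpS : p ∈ S \ {0} := extremePoints_convexHull_subset hp
  obtain ⟨g, hg, hgsum⟩ := (Set.mem_fintype_sum _ _).1 hpS.1
  -- membership of modified sums
  have mem_S : ∀ g' : Fin m → E, (∀ j, g' j ∈ (A j : Set E)) → ∑ j, g' j ∈ S := fun g' hg' =>
    (Set.mem_fintype_sum _ _).2 ⟨g', hg', rfl⟩
  by_cases hone : ∃ j₁ j₂, j₁ ≠ j₂ ∧ g j₁ ≠ 0 ∧ g j₂ ≠ 0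
  · obtain ⟨j₁, j₂, hne, h1, h2⟩ := hone
    set a : E := g j₁ with ha
    set b : E := ∑ j, Function.update g j₁ 0 j with hb
    have hab : p = a + b := by
      rw [← hgsum, hb, ha]
      rw [← Finset.add_sum_erase Finset.univ g (Finset.mem_univ j₁),
        ← Finset.add_sum_erase Finset.univ (Function.update g j₁ 0) (Finset.mem_univ j₁),
        Function.update_self, zero_add]
      congr 1
      exact Finset.sum_congr rfl fun j hj => by rw [Function.update_of_ne (Finset.ne_of_mem_erase hj)]
    by_cases hb0 : b = 0
    · right
      refine ⟨j₁, ?_⟩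
      have : p = a := by rw [hab, hb0, add_zero]
      rw [this, ha]
      exact hg j₁
    · left
      have haS : a ∈ S := by
        have := mem_S (Function.update (fun _ => (0 : E)) j₁ (g j₁)) (fun j => by
          by_cases hj : j = j₁
          · subst hj; rw [Function.update_self]; exact hg j
          · rw [Function.update_of_ne hj]; exact h0 j)
        rwa [Finset.sum_update_of_mem (Finset.mem_univ j₁), Finset.sum_const_zero, add_zero] at this
      have hbS : b ∈ S := mem_S _ (fun j => by
        by_cases hj : j = j₁
        · subst hj; rw [Function.update_self]; exact h0 j
        · rw [Function.update_of_ne hj]; exact hg j)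
      -- strict exposure of p in conv (S \ {0})
      obtain ⟨l, hl⟩ := exists_strict_exposing_of_finite (hSfin.subset Set.sdiff_subset) hp
      have hK := KPTT.convexHull_subset_insert_halfSpace (S := S \ {0}) (p := p) l hl
      have haK : a = p ∨ l a < l p := hK (subset_convexHull ℝ _ ⟨haS, h1⟩)
      have hbK : b = p ∨ l b < l p := hK (subset_convexHull ℝ _ ⟨hbS, hb0⟩)
      have hlp : l p = l a + l b := by rw [hab, map_add]
      have hp0 : p ≠ 0 := hpS.2
      have hpos : 0 < l p := by
        rcases haK with hap | hap <;> rcases hbK with hbp | hbp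
        · exfalso; apply hp0
          have h2 : p = p + p := by rw [hap, hbp] at hab; exact hab
          have h3 : p + p = p + 0 := by rw [add_zero]; exact h2.symm
          exact add_left_cancel h3
        · rw [hap] at hlp; linarith
        · rw [hbp] at hlp; linarith
        · linarith
      refine KPTT.mem_extremePoints_convexHull_of_linear hpS.1 l fun x hx hxp => ?_
      by_cases hx0 : x = 0
      · rw [hx0, map_zero]; exact hpos
      · exact hl x ⟨hx, hx0⟩ hxp
  · -- at most one nonzero summand: p is that summand
    right
    push Not at hone
    by_cases hall : ∀ j, g j = 0
    · exfalso
      apply hpS.2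
      rw [← hgsum]
      exact Finset.sum_eq_zero fun j _ => hall j
    · push Not at hall
      obtain ⟨j₁, hj₁⟩ := hall
      refine ⟨j₁, ?_⟩
      have : p = g j₁ := by
        rw [← hgsum, Finset.sum_eq_single j₁ (fun j _ hj => hone j₁ j (Ne.symm hj) hj₁)
          (fun h => absurd (Finset.mem_univ j₁) h)]
      rw [this]; exact hg j₁

/-- Counting form of F8: deleting the origin from a cancellation-free `m`-fold product support creates at
most `Σ_j (#A_j − 1)` vertices beyond those of the full support. [folklore] -/
theorem ncard_extremePoints_sdiff_zero_le {m : ℕ} (A : Fin m → Finset E) (h0 : ∀ j, (0 : E) ∈ A j) :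
    ((convexHull ℝ ((∑ j, (A j : Set E)) \ {0})).extremePoints ℝ).ncard ≤
      ((convexHull ℝ (∑ j, (A j : Set E))).extremePoints ℝ).ncard + ∑ j, ((A j).card - 1) := by
  classical
  set S : Set E := ∑ j, (A j : Set E) with hS
  set F : Finset E := Finset.univ.biUnion fun j => (A j).erase 0 with hF
  have hSfin : S.Finite := finite_fintype_sum A
  have hVfin : ((convexHull ℝ S).extremePoints ℝ).Finite := hSfin.subset extremePoints_convexHull_subset
  have hsub : (convexHull ℝ (S \ {0})).extremePoints ℝ ⊆ (convexHull ℝ S).extremePoints ℝ ∪ (F : Set E) := by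
    intro p hp
    rcases extremePoint_sdiff_zero_of_sum A h0 hp with h | ⟨j, hj⟩
    · exact Or.inl h
    · refine Or.inr ?_
      have hp0 : p ≠ 0 := (extremePoints_convexHull_subset hp).2
      simp only [hF, Finset.coe_biUnion, Finset.coe_univ, Set.mem_univ, Set.iUnion_true, Set.mem_iUnion,
        Finset.coe_erase, Set.mem_sdiff, Finset.mem_coe, Set.mem_singleton_iff]
      exact ⟨j, hj, hp0⟩
  have hFcard : F.card ≤ ∑ j, ((A j).card - 1) := by
    refine Finset.card_biUnion_le.trans (Finset.sum_le_sum fun j _ => ?_)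
    rw [Finset.card_erase_of_mem (h0 j)]
  calc ((convexHull ℝ (S \ {0})).extremePoints ℝ).ncard
      ≤ ((convexHull ℝ S).extremePoints ℝ ∪ (F : Set E)).ncard :=
        Set.ncard_le_ncard hsub (hVfin.union F.finite_toSet)
    _ ≤ ((convexHull ℝ S).extremePoints ℝ).ncard + (F : Set E).ncard := Set.ncard_union_le _ _
    _ ≤ ((convexHull ℝ S).extremePoints ℝ).ncard + ∑ j, ((A j).card - 1) := by
        rw [Set.ncard_coe_finset]; exact Nat.add_le_add_left hFcard _

/-! ### Polynomial form (the crux's own objects) -/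

section Poly

open MvPolynomial

/-- The crux's embedding of exponent vectors into the plane, as an additive monoid hom (a helper `def`, not a fact). -/
noncomputable def ιHom : (Fin 2 →₀ ℕ) →+ (Fin 2 → ℝ) where
  toFun e i := ((e i : ℕ) : ℝ)
  map_zero' := by ext i; simp
  map_add' e e' := by ext i; simp

/-- `ιHom` evaluated. [folklore] -/
@[simp] theorem ιHom_apply (e : Fin 2 →₀ ℕ) (i : Fin 2) : ιHom e i = ((e i : ℕ) : ℝ) := rfl

/-- `ιHom` is injective. [folklore] -/
theorem ιHom_injective : Function.Injective ιHom := fun e e' h => by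
  ext i; have := congrArg (fun q => q i) h; simpa using this

/-- Support of `P` minus its constant term: the support with the origin erased. [folklore] -/
theorem support_sub_C_coeff_zero (P : MvPolynomial (Fin 2) ℂ) :
    (P - C (coeff 0 P)).support = P.support.erase 0 := by
  classical
  ext e
  rw [mem_support_iff, Finset.mem_erase, mem_support_iff, coeff_sub, coeff_C]
  by_cases he : e = 0
  · subst he; simp
  · rw [if_neg (Ne.symm he), sub_zero]
    exact ⟨fun h => ⟨he, h⟩, fun h => h.2⟩

/-- **F8 for polynomials.**  If the product `∏ f_j` has NO internal cancellation — its support is the full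
Minkowski sum of the supports — and every factor has a constant term, then cancelling the constant term of the
product (the `m`-factor instance `∏ f_j − c` of the crux with `g ≡` const) creates at most `Σ_j (|supp f_j| − 1)`
vertices beyond the `≤ Σ_j |vert f_j|` of `Newt(∏ f_j)` itself.  All the difficulty of KPTT §5.2 / of the crux at
`g ≡ 1` is therefore INTERNAL cancellation. [folklore] -/
theorem newtonVertexCount_sub_const_le_of_support_eq_sum {m : ℕ} (f : Fin m → MvPolynomial (Fin 2) ℂ)
    (hsupp : (∏ j, f j).support = ∑ j, (f j).support) (h0 : ∀ j, coeff 0 (f j) ≠ 0) :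
    newtonVertexCount (∏ j, f j - C (coeff 0 (∏ j, f j))) ≤ newtonVertexCount (∏ j, f j) + ∑ j, ((f j).support.card - 1) := by
  classical
  set P := ∏ j, f j with hP
  let A : Fin m → Finset (Fin 2 → ℝ) := fun j => (f j).support.image ιHom
  have hι : (fun e : Fin 2 →₀ ℕ => fun i : Fin 2 => ((e i : ℕ) : ℝ)) = ⇑ιHom := rfl
  have hA0 : ∀ j, (0 : Fin 2 → ℝ) ∈ A j := fun j =>
    Finset.mem_image.2 ⟨0, mem_support_iff.2 (h0 j), map_zero ιHom⟩
  have hAcard : ∀ j, (A j).card = (f j).support.card := fun j =>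
    Finset.card_image_of_injective _ ιHom_injective
  -- the two supports, pushed into the plane
  have hS : (⇑ιHom '' (P.support : Set (Fin 2 →₀ ℕ))) = ∑ j, (A j : Set (Fin 2 → ℝ)) := by
    rw [hsupp, Finset.coe_sum, Set.image_finsetSum]
    simp [A, Finset.coe_image]
  have hS0 : (⇑ιHom '' ((P - C (coeff 0 P)).support : Set (Fin 2 →₀ ℕ))) =
      (∑ j, (A j : Set (Fin 2 → ℝ))) \ {0} := by
    rw [support_sub_C_coeff_zero, Finset.coe_erase, Set.image_sdiff ιHom_injective, Set.image_singleton,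
      map_zero, hS]
  unfold newtonVertexCount
  rw [hι, hS0, hS]
  calc ((convexHull ℝ ((∑ j, (A j : Set (Fin 2 → ℝ))) \ {0})).extremePoints ℝ).ncard
      ≤ ((convexHull ℝ (∑ j, (A j : Set (Fin 2 → ℝ)))).extremePoints ℝ).ncard + ∑ j, ((A j).card - 1) :=
        ncard_extremePoints_sdiff_zero_le A hA0
    _ = _ := by simp only [hAcard]

end Poly

end

end Summit.ValiantsHypothesis.ValiantsHypothesis.Theorems.TwoProducts.Negative
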